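import Mathlib
import Summits.Schanuel.Schanuel.Theses.RigidCore
import Summits.Schanuel.Schanuel.Theorems.RigidCoreSchanuelOnLogFreeCoreCalibrationR
import Literature.Barriers.Schanuel.AlgebraicIndependenceOfLogarithms

/-!
# Crux `RigidCore.SchanuelOnLogFreeCore` (R), line `sector-split`, stub C25: (R) ⟹ `π, e, eᵉ, e^{eᵉ}, …` are algebraically independent

Support file for crux `stmt-Schanuel-0970`
(`Summit.Schanuel.Schanuel.Theses.RigidCore.SchanuelOnLogFreeCore`, "(R)": Schanuel's statement for
`ℚ`-linearly independent tuples from the log-free core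
`C_EA = logFreeCore = sInf {K ≤ ℂ | 2πi ∈ K, K exp-closed, K relatively algebraically closed}`),
registered stub `stub_expTower_of_crux` of skeleton v26 (lead c12, wave 3).

* `stub_expTower_of_crux` (registered signature verbatim): **(R) ⟹ for every `n`, the `n + 1`
  numbers `π, e, eᵉ, e^{eᵉ}, …, exp^[n] 1` are algebraically independent over `ℚ`** (family
  `Fin (n+1) → ℂ`, index `0 ↦ π`, index `k ≥ 1 ↦ exp^[k] 1`).  PROOF (`ExpTower.step`, induction on
  `n`): (R) at the CORE tuple `x = (2πi, 1, e, eᵉ, …, exp^[n] 1)` of rank `n + 2` — its entries lie in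
  `C_EA` (`2πi`, and the real tower `exp^[k] 1` by `exp`-closure from `1`), and it is `ℚ`-linearly
  independent because the imaginary part of a rational relation isolates `2πi` while the real tail
  `1, e, …, exp^[n] 1` is `ℚ`-free (the sub-tower `e, …, exp^[n] 1` is algebraically independent by the
  induction hypothesis, and `1` together with an algebraically independent family is linearly
  independent: distinct monomials `1, X₁, …, X_m` are linearly independent in `ℚ[X]`,
  `ExpTower.linearIndependent_cons_one`) — gives
  `n + 2 ≤ trdeg ℚ(x, eˣ) ≤ trdeg ℚ(π, e, …, exp^[n+1] 1, i) = trdeg ℚ(π, e, …, exp^[n+1] 1)`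
  (`e^{2πi} = 1`, `i` algebraic), i.e. the `n + 2` numbers are algebraically independent
  (`algebraicIndependent_of_le_trdeg_adjoin`).  Base: `π` is transcendental (Lindemann).
* Instances (namespace `ExpTower`): **(R) ⟹ `π, e, eᵉ` algebraically independent**
  (`pi_e_expE_of_crux`), **(R) ⟹ `e^{eᵉ}` and `eᵉ` transcendental** (`transcendental_expExpE_of_crux`,
  `transcendental_expE_of_crux`) — printed open; not even the irrationality of `eᵉ` is known.  With
  the same wave's worker stub C26 `stub_piTower_of_crux` (`…PiTower.lean`: (R) ⟹ `π, e^π, e^{e^π}, …`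
  algebraically independent) the crux is calibrated against both classical exponential towers.

What is NOT claimed: (R) (open, `⊇ e ⊥ π` — which is this statement at `n = 1`).  Sources: J. Kirby,
*Exponential algebraicity in exponential fields*, Bull. LMS 42 (2010), arXiv:0810.4285, Prop. 7.2
(the core); the tower statement is folklore (Schanuel's conjecture at `(2πi, 1, e, eᵉ, …)`, cf.
S. Lang, *Introduction to transcendental numbers* (1966), pp. 30–31); F. Lindemann (1882) for `π`
(tree `transcendental_pi_holds`, through `CalibrationR.transcendental_pi_complex`); the field-theoretic
glue is the tree's (`Literature.Barriers.Schanuel.algebraicIndependent_of_le_trdeg_adjoin`,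
`trdeg_adjoin_union_eq_of_isAlgebraic`, `isAlgebraic_I`; `CalibrationA.trdeg_mono`,
`CalibrationR.schanuelOnLogFreeCore_iff`).
-/

noncomputable section

set_option linter.dupNamespace false

open Summit.Schanuel.Schanuel.Theses
open Summit.Schanuel.Schanuel.Theorems.AclSubsetLogFreeCore.Negative

namespace Summit.Schanuel.Schanuel.Theorems.RigidCore

namespace ExpTower

open Complex IntermediateField

/-! ## The real tower `1, e, eᵉ, …` -/

/-- The iterated exponentials of `1` are real numbers: `exp^[k] 1 = ((Real.exp^[k] 1 : ℝ) : ℂ)`.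
[folklore] -/
theorem iterate_exp_one_eq_ofReal (k : ℕ) :
    Complex.exp^[k] (1 : ℂ) = ((Real.exp^[k] 1 : ℝ) : ℂ) := by
  induction k with
  | zero => simp
  | succ k ih =>
    rw [Function.iterate_succ_apply', Function.iterate_succ_apply', ih, Complex.ofReal_exp]

/-- The iterated exponentials of `1` have zero imaginary part. [folklore] -/
theorem iterate_exp_one_im (k : ℕ) : (Complex.exp^[k] (1 : ℂ)).im = 0 := by
  rw [iterate_exp_one_eq_ofReal, Complex.ofReal_im]

/-- Every `exp^[k] 1` lies in the log-free core (`1 ∈ C_EA`, `C_EA` is `exp`-closed). [folklore] -/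
theorem iterate_exp_one_mem_logFreeCore (k : ℕ) : Complex.exp^[k] (1 : ℂ) ∈ logFreeCore := by
  induction k with
  | zero => exact one_mem _
  | succ k ih =>
    rw [Function.iterate_succ_apply']
    exact logFreeCore_mem_coreFamily.2.1 _ ih

/-! ## `1` next to an algebraically independent family is linearly independent -/

/-- If `x : Fin m → ℂ` is algebraically independent over `ℚ`, then `1, x₁, …, x_m` are `ℚ`-linearly
independent: a rational relation is the value at `x` of the linear polynomial `c₀ + Σ cₖ Xₖ`, which
must vanish identically, and the monomials `1, X₁, …, X_m` are linearly independent in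
`MvPolynomial (Fin m) ℚ` (they are part of the monomial basis). [folklore] -/
theorem linearIndependent_cons_one {m : ℕ} {x : Fin m → ℂ} (hx : AlgebraicIndependent ℚ x) :
    LinearIndependent ℚ (Fin.cons (1 : ℂ) x : Fin (m + 1) → ℂ) := by
  classical
  -- the polynomial family `q = (1, X₀, …, X_{m-1})` and its exponent vectors
  let s : Fin (m + 1) → (Fin m →₀ ℕ) := Fin.cons 0 fun k => Finsupp.single k 1
  have hs : Function.Injective s := by
    refine Fin.cons_injective_iff.2 ⟨?_, Finsupp.single_left_injective one_ne_zero⟩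
    rintro ⟨k, hk⟩
    exact one_ne_zero (Finsupp.single_eq_zero.mp hk)
  let q : Fin (m + 1) → MvPolynomial (Fin m) ℚ := fun i => MvPolynomial.monomial (s i) 1
  have hq : LinearIndependent ℚ q := by
    have hb := (MvPolynomial.basisMonomials (Fin m) ℚ).linearIndependent
    rw [MvPolynomial.coe_basisMonomials] at hb
    exact hb.comp s hs
  -- values of `q` at `x`
  have hqx : ∀ i, MvPolynomial.aeval x (q i) = (Fin.cons (1 : ℂ) x : Fin (m + 1) → ℂ) i := by
    intro i
    induction i using Fin.cases with
    | zero => simp [q, s]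
    | succ k => simp [q, s, MvPolynomial.aeval_monomial]
  rw [Fintype.linearIndependent_iff]
  intro c hc
  -- the linear polynomial `Σ cᵢ qᵢ` vanishes at `x`, hence is `0`
  have hP : MvPolynomial.aeval x (∑ i, c i • q i) = 0 := by
    rw [map_sum]
    simp_rw [map_smul, hqx]
    exact hc
  have hP0 : ∑ i, c i • q i = 0 := by
    have hinj := (algebraicIndependent_iff_injective_aeval.mp hx)
    exact hinj (by rw [hP, map_zero])
  exact Fintype.linearIndependent_iff.mp hq c hP0

/-! ## The core tuple of the induction step

`x = (2πi, 1, e, …, exp^[n] 1) = Fin.cons (2πi) (fun k : Fin (n+1) => exp^[k] 1) : Fin (n + 2) → ℂ`. -/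

/-- The core tuple `(2πi, 1, e, …, exp^[n] 1)` lies in the log-free core. [folklore] -/
theorem coreTuple_mem_logFreeCore (n : ℕ) (i : Fin (n + 2)) :
    (Fin.cons (2 * ↑Real.pi * Complex.I) (fun k : Fin (n + 1) => Complex.exp^[(k : ℕ)] (1 : ℂ)) :
      Fin (n + 2) → ℂ) i ∈ logFreeCore := by
  refine Fin.cases ?_ (fun k => ?_) i
  · rw [Fin.cons_zero]; exact two_pi_I_mem_logFreeCore
  · rw [Fin.cons_succ]; exact iterate_exp_one_mem_logFreeCore k

/-- The real tail `1, e, …, exp^[n] 1` is `1` followed by the shifted tower `e, …, exp^[n] 1`.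
[folklore] -/
theorem tail_eq_cons (n : ℕ) :
    (fun k : Fin (n + 1) => Complex.exp^[(k : ℕ)] (1 : ℂ)) =
      (Fin.cons (1 : ℂ) (fun k : Fin n => Complex.exp^[(k : ℕ) + 1] (1 : ℂ)) : Fin (n + 1) → ℂ) := by
  funext k
  induction k using Fin.cases with
  | zero => simp
  | succ k => simp [Fin.cons_succ]

/-- The core tuple is `ℚ`-linearly independent as soon as the shifted tower `e, …, exp^[n] 1` is
algebraically independent (imaginary part isolates `2πi`; the real tail `1, e, …` is `ℚ`-free by
`linearIndependent_cons_one`). [folklore] -/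
theorem linearIndependent_coreTuple (n : ℕ)
    (ih : AlgebraicIndependent ℚ (fun k : Fin n => Complex.exp^[(k : ℕ) + 1] (1 : ℂ))) :
    LinearIndependent ℚ
      (Fin.cons (2 * ↑Real.pi * Complex.I) (fun k : Fin (n + 1) => Complex.exp^[(k : ℕ)] (1 : ℂ)) :
        Fin (n + 2) → ℂ) := by
  rw [Fintype.linearIndependent_iff]
  intro c hc
  rw [Fin.sum_univ_succ] at hc
  simp only [Fin.cons_zero, Fin.cons_succ] at hc
  have h0 : c 0 = 0 := by
    have him := congrArg Complex.im hc
    rw [Complex.add_im, Complex.im_sum] at him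
    simp only [Complex.smul_im, iterate_exp_one_im, smul_zero, Finset.sum_const_zero, add_zero,
      Complex.zero_im] at him
    have h2pi : (2 * ↑Real.pi * Complex.I : ℂ).im = 2 * Real.pi := by simp
    rw [h2pi, Rat.smul_def] at him
    have hpi : (2 * Real.pi : ℝ) ≠ 0 := by positivity
    exact_mod_cast (mul_eq_zero.mp him).resolve_right hpi
  have hrest : ∀ k : Fin (n + 1), c k.succ = 0 := by
    rw [h0, zero_smul, zero_add] at hc
    have hli := linearIndependent_cons_one ih
    rw [← tail_eq_cons] at hli
    exact Fintype.linearIndependent_iff.mp hli (fun k => c k.succ) hc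
  intro i
  exact Fin.cases h0 hrest i

/-! ## The tower family and the induction -/

/-- The family of the statement: index `0 ↦ π`, index `k ≥ 1 ↦ exp^[k] 1`. -/
theorem family_zero (n : ℕ) :
    (fun k : Fin (n + 1) => if (k : ℕ) = 0 then (Real.pi : ℂ) else Complex.exp^[(k : ℕ)] 1) 0 =
      (Real.pi : ℂ) := by
  simp

/-- Values of the family at positive indices. -/
theorem family_of_ne_zero (n : ℕ) (k : Fin (n + 1)) (hk : (k : ℕ) ≠ 0) :
    (fun k : Fin (n + 1) => if (k : ℕ) = 0 then (Real.pi : ℂ) else Complex.exp^[(k : ℕ)] 1) k =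
      Complex.exp^[(k : ℕ)] 1 := by
  simp [hk]

/-- The shifted tower `e, …, exp^[n] 1` is the family at the indices `1, …, n`; so it is
algebraically independent when the family is. [folklore] -/
theorem shiftedTower_of_family (n : ℕ)
    (h : AlgebraicIndependent ℚ
      (fun k : Fin (n + 1) => if (k : ℕ) = 0 then (Real.pi : ℂ) else Complex.exp^[(k : ℕ)] 1)) :
    AlgebraicIndependent ℚ (fun k : Fin n => Complex.exp^[(k : ℕ) + 1] (1 : ℂ)) := by
  have h' := h.comp Fin.succ (Fin.succ_injective n)
  convert h' using 1
  funext k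
  simp [Function.comp_apply, Fin.val_succ]

/-- **Induction step.**  If `π, e, …, exp^[n] 1` are algebraically independent, then (R) at the
`ℚ`-linearly independent core tuple `x = (2πi, 1, e, …, exp^[n] 1)` gives
`n + 2 ≤ trdeg ℚ(x, eˣ) ≤ trdeg ℚ(π, e, …, exp^[n+1] 1, i) = trdeg ℚ(π, e, …, exp^[n+1] 1)`
(`e^{2πi} = 1`, `i` algebraic), so the `n + 2` numbers `π, e, …, exp^[n+1] 1` are algebraically
independent. [folklore] -/
theorem step (hR : RigidCore.SchanuelOnLogFreeCore) (n : ℕ)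
    (ih : AlgebraicIndependent ℚ
      (fun k : Fin (n + 1) => if (k : ℕ) = 0 then (Real.pi : ℂ) else Complex.exp^[(k : ℕ)] 1)) :
    AlgebraicIndependent ℚ
      (fun k : Fin (n + 2) => if (k : ℕ) = 0 then (Real.pi : ℂ) else Complex.exp^[(k : ℕ)] 1) := by
  -- adapted from `PiTower.step` / `CalibrationR.piLogTwo_of_schanuelOnLogFreeCore`
  have hR' := CalibrationR.schanuelOnLogFreeCore_iff.mp hR
  set w : Fin (n + 2) → ℂ :=
    fun k => if (k : ℕ) = 0 then (Real.pi : ℂ) else Complex.exp^[(k : ℕ)] 1 with hw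
  apply Literature.Barriers.Schanuel.algebraicIndependent_of_le_trdeg_adjoin w
  set x : Fin (n + 2) → ℂ :=
    Fin.cons (2 * ↑Real.pi * Complex.I) (fun k : Fin (n + 1) => Complex.exp^[(k : ℕ)] (1 : ℂ))
    with hx
  have h1 := hR' (n + 2) x (coreTuple_mem_logFreeCore n)
    (linearIndependent_coreTuple n (shiftedTower_of_family n ih))
  have hx0 : x 0 = 2 * ↑Real.pi * Complex.I := Fin.cons_zero _ _
  have hxs : ∀ k : Fin (n + 1), x k.succ = Complex.exp^[(k : ℕ)] (1 : ℂ) := fun k =>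
    Fin.cons_succ _ _ k
  have hw0 : w 0 = (Real.pi : ℂ) := by simp [hw]
  have hws : ∀ k : Fin (n + 1), w k.succ = Complex.exp (Complex.exp^[(k : ℕ)] (1 : ℂ)) := by
    intro k
    have hk : ((k.succ : Fin (n + 2)) : ℕ) ≠ 0 := by simp [Fin.val_succ]
    show (if ((k.succ : Fin (n + 2)) : ℕ) = 0 then (Real.pi : ℂ)
      else Complex.exp^[((k.succ : Fin (n + 2)) : ℕ)] 1) = _
    rw [if_neg hk, Fin.val_succ, Function.iterate_succ_apply']
  have hwc : ∀ k : Fin (n + 1), (k : ℕ) ≠ 0 → w (Fin.castSucc k) = Complex.exp^[(k : ℕ)] (1 : ℂ) := by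
    intro k hk
    have hk' : ((Fin.castSucc k : Fin (n + 2)) : ℕ) ≠ 0 := by simpa [Fin.val_castSucc] using hk
    show (if ((Fin.castSucc k : Fin (n + 2)) : ℕ) = 0 then (Real.pi : ℂ)
      else Complex.exp^[((Fin.castSucc k : Fin (n + 2)) : ℕ)] 1) = _
    rw [if_neg hk', Fin.val_castSucc]
  have hpi_mem : (Real.pi : ℂ) ∈ adjoin ℚ (Set.range w) := hw0 ▸ subset_adjoin ℚ _ ⟨0, rfl⟩
  have hI : I ∈ adjoin ℚ (Set.range w ∪ {I}) := subset_adjoin ℚ _ (Or.inr rfl)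
  have hmono : adjoin ℚ (Set.range w) ≤ adjoin ℚ (Set.range w ∪ {I}) :=
    adjoin.mono ℚ _ _ Set.subset_union_left
  have hle : adjoin ℚ (Set.range x ∪ Set.range (Complex.exp ∘ x)) ≤
      adjoin ℚ (Set.range w ∪ {I}) := by
    rw [adjoin_le_iff]
    rintro z (⟨i, rfl⟩ | ⟨i, rfl⟩)
    · refine Fin.cases ?_ (fun k => ?_) i
      · rw [hx0]
        exact mul_mem (mul_mem (ofNat_mem _ 2) (hmono hpi_mem)) hI
      · rw [hxs k]
        by_cases hk : (k : ℕ) = 0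
        · rw [hk, Function.iterate_zero, id]
          exact one_mem _
        · exact hmono ((hwc k hk) ▸ subset_adjoin ℚ _ ⟨Fin.castSucc k, rfl⟩)
    · refine Fin.cases ?_ (fun k => ?_) i
      · rw [Function.comp_apply, hx0, Complex.exp_two_pi_mul_I]
        exact one_mem _
      · rw [Function.comp_apply, hxs k]
        exact hmono ((hws k) ▸ subset_adjoin ℚ _ ⟨k.succ, rfl⟩)
  have hunion : Algebra.trdeg ℚ (adjoin ℚ (Set.range w ∪ {I})) =
      Algebra.trdeg ℚ (adjoin ℚ (Set.range w)) :=
    Literature.Barriers.Schanuel.trdeg_adjoin_union_eq_of_isAlgebraic (K := ℚ) (Set.range w)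
      ({I} : Set ℂ) (fun z hz => by
        rw [Set.mem_singleton_iff.mp hz]
        exact Literature.Barriers.Schanuel.isAlgebraic_I)
  exact (h1.trans (CalibrationA.trdeg_mono hle)).trans_eq hunion

/-- **Base**: `π` alone is algebraically independent (Lindemann). [cite: Lindemann1882] -/
theorem base :
    AlgebraicIndependent ℚ
      (fun k : Fin 1 => if (k : ℕ) = 0 then (Real.pi : ℂ) else Complex.exp^[(k : ℕ)] 1) := by
  refine (algebraicIndependent_singleton_iff (0 : Fin 1)).mpr ?_
  simpa using CalibrationR.transcendental_pi_complex

/-- **(R) ⟹ the `e`-tower with `π` is algebraically independent**: for every `n`, the numbers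
`π, e, eᵉ, …, exp^[n] 1` are algebraically independent over `ℚ` (induction on `n` by `step`).
[folklore] -/
theorem tower (hR : RigidCore.SchanuelOnLogFreeCore) :
    ∀ n : ℕ, AlgebraicIndependent ℚ
      (fun k : Fin (n + 1) => if (k : ℕ) = 0 then (Real.pi : ℂ) else Complex.exp^[(k : ℕ)] 1)
  | 0 => base
  | n + 1 => step hR n (tower hR n)

/-! ### Photogenic instances -/

/-- **(R) ⟹ `π, e, eᵉ` are algebraically independent** (the tower at `n = 2`; printed open — (R)
at `n = 1` is already `e ⊥ π`). [folklore] -/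
theorem pi_e_expE_of_crux (hR : RigidCore.SchanuelOnLogFreeCore) :
    AlgebraicIndependent ℚ ![(Real.pi : ℂ), Complex.exp 1, Complex.exp (Complex.exp 1)] := by
  have h := tower hR 2
  convert h using 1
  funext k
  fin_cases k <;> rfl

/-- **(R) ⟹ `e^{eᵉ}` is transcendental** (not even the irrationality of `eᵉ` is known). [folklore] -/
theorem transcendental_expExpE_of_crux (hR : RigidCore.SchanuelOnLogFreeCore) :
    Transcendental ℚ (Complex.exp (Complex.exp (Complex.exp 1))) := by
  have h := tower hR 3
  have h3 := h.transcendental 3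
  simpa using h3

/-- **(R) ⟹ `eᵉ` is transcendental** (Schneider's eighth problem asks less: `eᵉ ∉ ℚ̄` is open;
Brownawell–Waldschmidt: `eᵉ` and `e^{e²}` are not both algebraic). [folklore] -/
theorem transcendental_expE_of_crux (hR : RigidCore.SchanuelOnLogFreeCore) :
    Transcendental ℚ (Complex.exp (Complex.exp 1)) := by
  simpa using (pi_e_expE_of_crux hR).transcendental 2

end ExpTower

/-! ## The registered stub -/

/-- **Registered stub `stub_expTower_of_crux` (C25) of line `sector-split`** (signature verbatim):
the crux (R) — Schanuel's statement for `ℚ`-linearly independent tuples from the log-free core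
`C_EA = sInf {K ≤ ℂ | 2πi ∈ K, K exp-closed, K relatively algebraically closed}` — implies that for
every `n` the numbers `π, e, eᵉ, e^{eᵉ}, …, exp^[n] 1` are algebraically independent over `ℚ`
(induction on `n`: (R) at the `ℚ`-free core tuple `(2πi, 1, e, …, exp^[n] 1)`, then `e^{2πi} = 1`
and `i` algebraic; proof `ExpTower.tower`).  Printed open from `n = 1` on (`e ⊥ π`); this
calibrates (R), it closes nothing. [folklore] -/
theorem stub_expTower_of_crux :
    RigidCore.SchanuelOnLogFreeCore →
      ∀ n : ℕ, AlgebraicIndependent ℚ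
        (fun k : Fin (n + 1) => if (k : ℕ) = 0 then (Real.pi : ℂ) else Complex.exp^[(k : ℕ)] 1) := by
  intro hR n
  exact ExpTower.tower hR n

end Summit.Schanuel.Schanuel.Theorems.RigidCore

end
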